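/-
Origin: expansion seat `planner-pub-hodgecm-prl1-g3-0`, handover #2 2026-08-18T05:47:35Z (`HOME/pub-hodgecm-prl1-g3/lean/Prl1g3/ThetaCarrierRep.lean`, md5 015ee355, 426 lines);
landed by the gen-6 packager in gate run 23 as `HodgeCM/Automorphic/ThetaCarrierRep.lean` (import ^import Prl1g3\.→import HodgeCM.Automorphic. ×1).
-/
/-
Origin: HOME/pub-hodgecm-prl1-g3/lean/Prl1g3/ThetaCarrierRep.lean — session planner-pub-hodgecm-prl1-g3-0
(unit pub-hodgecm-prl1-g3, EXPANSION PROVER a-1 gen 3: CONSTRUCT the realisation).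
Intended final place (packager's call): `HodgeCM/Automorphic/ThetaCarrierRep.lean`; module rename
`Prl1g3.IsotypicDecomposition` ↦ `HodgeCM.Automorphic.IsotypicDecomposition` (mine, handed over before this file);
`HodgeCM.Automorphic.ThetaCarrier` and `HodgeCM.Assembly.CorCMCarrier` are LANDED (gen 2, gate run 22).
NEW, ADDITIVE; touches no existing file.

KIND: L2 (a smaller hypothesis record) + KERNEL (the discharges) + L5 glue (end-state corollaries).
ONE hypothesis field carries a citation of a PUBLISHED theorem (verbatim, with page): `RepCoreCarrier.Analytic.discreteDecomp`
— see its docstring.  Nothing else is cited; nothing is posited.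
-/
import Summits.HodgeConjecture.HodgeCM.Automorphic.IsotypicDecomposition_2
import Summits.HodgeConjecture.HodgeCM.Automorphic.ThetaCarrier_2
import Summits.HodgeConjecture.HodgeCM.Assembly.CorCMCarrier

set_option autoImplicit false

/-!
# The theta carrier with its isotypic decomposition DEFINED — five analytic axioms per context discharged

Gen 2 (`HodgeCM.Automorphic.ThetaCarrier`) replaced the three Prior records of a theta model by PROP-FREE carriers
`CoreCarrier` / `TorusCarrier` / `Universe.ThetaCarrier` plus ONE hypothesis record `Analytic` of 6 + 7 + 7 = 20 named
propositions per seesaw context (PerL v5 §3.3).  Among the carried DATA were the isotypic components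
`hatσ : SigIdx → Submodule ℂ H` of `L²([U(W)])`, the `w`-eigenspace `Ew` and the predicate `wOccurs`, about which
five of the twenty propositions speak: `hatσ_invariant`, `hatσ_ortho`, `AX9_espectral` (core) and `AX9_w_vector`
(each torus side).

Here these data are no longer carried but DEFINED from the representation `R` (file `IsotypicDecomposition`):
`SigIdx := RepDecomp.IsoClass R` (unitary-equivalence classes of irreducible closed `R`-invariant subspaces),
`hatσ c := RepDecomp.isotypic R c`, `Ew := RepDecomp.Ew R torus w`, `wOccurs := RepDecomp.WOccurs R torus w`, where
the NEW prop-free data of a torus side are an index type `Tι`, the map `torus : Tι → G` (the compact torus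
`T(L₀ ⊗ ℝ) ⊂ U(W)(𝔸)`, PerL ll. 387–391) and its weight `w : Tι → ℂ`.  For the resulting carrier
(`RepCoreCarrier.toCoreCarrier`, `RepTorusCarrier.toTorusCarrier`, `Universe.RepThetaCarrier.toThetaCarrier`)
the five propositions are KERNEL THEOREMS (`toCoreCarrier_analytic`, `toTorusCarrier_analytic`), so the hypothesis
record shrinks to `RepCoreCarrier.Analytic` (3 fields: `R_unitary`, `discreteDecomp`, `hatτ_complete`) +
`RepTorusCarrier.Analytic` (6 fields) per torus side = 15 named propositions per context, and every landed theorem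
over `(D : U.ThetaCarrier) (hA : D.Analytic)` / `(T : U.ThetaModel)` applies to `D.toThetaCarrier` /
`ThetaModel.ofRepCarrier D hA` — in particular the prl1 target pair (`Assembly.realisationExists_ofRepCarrier`) and the
cell's END STATE (`Assembly.COR_CM_endState_ofRepCarrier_leaves'`).

Honesty ledger.  (i) `discreteDecomp` REPLACES gen 2's `hatσ_complete` and is EQUIVALENT to it for the defined
components (`RepDecomp.iSup_isotypic_eq`); it is the one field whose intended-model truth is a published theorem
quoted in its docstring.  (ii) The defined `σ̂`/`E_w`/`wOccurs` are the CANONICAL objects of PerL ll. 384–391, not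
arbitrary data satisfying axioms; downstream hypotheses mentioning them (`Inputs`, the carver's leaves) are thereby
statements about the canonical objects.  (iii) No analytic axiom other than the five is touched.
-/

noncomputable section

open scoped InnerProductSpace ComplexConjugate

namespace HodgeCM

open HodgeCM.Prior.Perl34File HodgeCM.Prior.Perl34File.Perl34

/-! ## 1. The core: `CoreCarrier` without `hatσ` -/

/-- **Representation-theoretic core carrier**: gen 2's `CoreCarrier` WITHOUT the field `hatσ` (and without the index
type `SigIdx`): both are defined from `R` (`SigIdx`, `toCoreCarrier`).  Prop-free. -/
structure RepCoreCarrier (H HG CG G SK SigIdxG : Type)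
    [NormedAddCommGroup H] [InnerProductSpace ℂ H] [CompleteSpace H]
    [NormedAddCommGroup HG] [InnerProductSpace ℂ HG] [CompleteSpace HG]
    [NormedAddCommGroup CG] [NormedSpace ℂ CG]
    [Group G] [TopologicalSpace G] [TopologicalSpace SK] where
  /-- AX9 (l. 382–383): the right regular representation `R` of `U(W)(𝔸)` on `L²([U(W)])` -/
  R : G →* (H →L[ℂ] H)
  /-- the Weil action `ω(h)` on the index set `𝒮^κ` -/
  omg : G → SK → SK
  /-- the theta kernel operators `𝒯_Φ : L²([U(W)]) → C([G_U])` -/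
  TΦc : SK → (H →L[ℂ] CG)
  /-- the bounded inclusion `C([G_U]) ⊆ L²([G_U])` -/
  inclCG : CG →L[ℂ] HG
  /-- AX1b(a): the isotypic components of `L²([G_U])` -/
  hatτ : SigIdxG → Submodule ℂ HG

namespace RepCoreCarrier

variable {H HG CG G SK SigIdxG : Type}
variable [NormedAddCommGroup H] [InnerProductSpace ℂ H] [CompleteSpace H]
variable [NormedAddCommGroup HG] [InnerProductSpace ℂ HG] [CompleteSpace HG]
variable [NormedAddCommGroup CG] [NormedSpace ℂ CG]
variable [Group G] [TopologicalSpace G] [TopologicalSpace SK]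
variable (C : RepCoreCarrier H HG CG G SK SigIdxG)

/-- **The index of the isotypic decomposition, DEFINED**: unitary-equivalence classes of irreducible closed
`R`-invariant subspaces of `H`. -/
abbrev SigIdx : Type := RepDecomp.IsoClass C.R

/-- **The gen-2 carrier of a representation-theoretic core**: `hatσ c :=` the isotypic component of the class `c`. -/
def toCoreCarrier : CoreCarrier H HG CG G SK C.SigIdx SigIdxG where
  R := C.R
  omg := C.omg
  TΦc := C.TΦc
  inclCG := C.inclCG
  hatσ := fun c => RepDecomp.isotypic C.R c
  hatτ := C.hatτ

/-- (Ported verbatim from the HodgeCMPerL package; no docstring in the source.) -/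
@[simp] theorem toCoreCarrier_R : C.toCoreCarrier.R = C.R := rfl
/-- (Ported verbatim from the HodgeCMPerL package; no docstring in the source.) -/
@[simp] theorem toCoreCarrier_omg : C.toCoreCarrier.omg = C.omg := rfl
/-- (Ported verbatim from the HodgeCMPerL package; no docstring in the source.) -/
@[simp] theorem toCoreCarrier_TΦc : C.toCoreCarrier.TΦc = C.TΦc := rfl
/-- (Ported verbatim from the HodgeCMPerL package; no docstring in the source.) -/
@[simp] theorem toCoreCarrier_inclCG : C.toCoreCarrier.inclCG = C.inclCG := rfl
/-- (Ported verbatim from the HodgeCMPerL package; no docstring in the source.) -/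
theorem toCoreCarrier_hatσ (c : C.SigIdx) : C.toCoreCarrier.hatσ c = RepDecomp.isotypic C.R c := rfl
/-- (Ported verbatim from the HodgeCMPerL package; no docstring in the source.) -/
@[simp] theorem toCoreCarrier_hatτ : C.toCoreCarrier.hatτ = C.hatτ := rfl
/-- (Ported verbatim from the HodgeCMPerL package; no docstring in the source.) -/
theorem toCoreCarrier_hatσC (c : C.SigIdx) :
    C.toCoreCarrier.hatσC c = (RepDecomp.isotypic C.R c).topologicalClosure := rfl

/-- **The remaining analytic axioms of the core — 3 of gen 2's 6** (`hatσ_invariant`, `hatσ_ortho`, `AX9_espectral`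
are theorems for the defined components: `toCoreCarrier_analytic`). -/
structure Analytic : Prop where
  /-- AX9 (l. 382–383): `R` is unitary (right Haar invariance on the compact quotient `[U(W)]`). -/
  R_unitary : ∀ (g : G) (u v : H), ⟪C.R g u, C.R g v⟫_ℂ = ⟪u, v⟫_ℂ
  /-- **Discrete decomposition** (replaces gen 2's `hatσ_complete`, to which it is equivalent for the defined
  components by `RepDecomp.iSup_isotypic_eq`): `H` is the closed span of its irreducible closed `R`-invariant
  subspaces.  PerL v5 ll. 384–385: "Since `[U(W)]` is compact (`U(W)` is anisotropic: `W` is definite at `ι₁`), …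
  `L²([U(W)])` is the Hilbert direct sum of its isotypic components `σ̂`, each a finite multiple of an irreducible
  unitary representation".  PUBLISHED THEOREM behind it (quoted verbatim): J. R. Getz, H. Hahn, *An Introduction to
  Automorphic Representations*, GTM 300, Springer 2024, Corollary 9.1.2 (p. 175): "The subspace `L²_cusp([G])`
  decomposes into a Hilbert space direct sum of irreducible representations of `G(𝔸_F)¹`, each occurring with finite
  multiplicity." (from Theorem 9.1.1 (Gelfand and Piatetski-Shapiro), p. 174, via Lemma 9.3.1, p. 179); for `G = U(W)`
  anisotropic over `L₀` there is no proper parabolic `L₀`-subgroup, so `L²_cusp([G]) = L²([G])`, and `G(𝔸)¹ = G(𝔸)`. -/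
  discreteDecomp : (⨆ V : RepDecomp.Irr C.R, (V.1 : Submodule ℂ H)).topologicalClosure = ⊤
  /-- AX1b(a) (ll. 264–268): completeness of the `G_U`-side decomposition (unchanged from gen 2). -/
  hatτ_complete : (⨆ j, C.hatτ j).topologicalClosure = ⊤

variable {C}

/-- (Ported verbatim from the HodgeCMPerL package; no docstring in the source.) -/
theorem Analytic.isUnitaryRep (h : C.Analytic) : PerL34.Spectral.IsUnitaryRep C.R := h.R_unitary

/-- **Gen 2's six core axioms from the three**: `hatσ_invariant` (`RepDecomp.isotypic_invariant`), `hatσ_ortho`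
(`RepDecomp.isotypic_closure_orthogonal`), `AX9_espectral` (`RepDecomp.starProjection_isotypic_mem`) are PROVED;
`hatσ_complete` is `discreteDecomp` transported along `RepDecomp.iSup_isotypic_eq`. -/
theorem toCoreCarrier_analytic (h : C.Analytic) : C.toCoreCarrier.Analytic where
  R_unitary := h.R_unitary
  hatσ_invariant := fun c g v hv => RepDecomp.isotypic_invariant c g v hv
  hatσ_ortho := fun _ _ hij => RepDecomp.isotypic_closure_orthogonal h.isUnitaryRep hij
  hatσ_complete := by
    show (⨆ c, RepDecomp.isotypic C.R c).topologicalClosure = ⊤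
    rw [RepDecomp.iSup_isotypic_eq]
    exact h.discreteDecomp
  AX9_espectral := fun M hM hinv c v hv => RepDecomp.starProjection_isotypic_mem h.isUnitaryRep c M hM hinv v hv
  hatτ_complete := h.hatτ_complete

end RepCoreCarrier

/-! ## 2. One torus side: `TorusCarrier` without `Ew`, `wOccurs`, with the torus as data -/

/-- **Representation-theoretic torus carrier**: gen 2's `TorusCarrier` WITHOUT the fields `Ew`, `wOccurs`, WITH the
prop-free data they are defined from — the compact torus `T(L₀ ⊗ ℝ)` as a family `torus : Tι → G` of elements of
`U(W)(𝔸)` and its weight `w : Tι → ℂ` (PerL v5 ll. 387–391). -/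
structure RepTorusCarrier {H HG CG G SK SigIdxG : Type}
    [NormedAddCommGroup H] [InnerProductSpace ℂ H] [CompleteSpace H]
    [NormedAddCommGroup HG] [InnerProductSpace ℂ HG] [CompleteSpace HG]
    [NormedAddCommGroup CG] [NormedSpace ℂ CG]
    [Group G] [TopologicalSpace G] [TopologicalSpace SK]
    (C : RepCoreCarrier H HG CG G SK SigIdxG) where
  /-- the characters `χ` of `[T]` with `χ_∞ = w` — bare index type -/
  X : Type
  /-- the test functions `f ∈ C_c^∞(U(W)(𝔸))` — bare index type -/
  TestFn : Type
  /-- `χ` arises from an allowed pair -/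
  allowed : X → Prop
  /-- the toric periods `ϑ_{T,χ}(Φ) ∈ C([G_U])` -/
  ϑc : X → SK → CG
  /-- AX12: the pseudo-Eisenstein vectors `E^χ_f` -/
  E : X → TestFn → H
  /-- index type of the elements of the compact torus `T(L₀ ⊗ ℝ)` (ll. 387–388) -/
  Tι : Type
  /-- the torus inside `U(W)(𝔸)`: `t ↦` its image in `G` -/
  torus : Tι → G
  /-- the weight (character) `w` of `T(L₀ ⊗ ℝ)` (l. 387) -/
  w : Tι → ℂ
  /-- the test-function twist `f ↦ f^{h₀}` -/
  ETransl : G → X → TestFn → TestFn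

namespace RepTorusCarrier

variable {H HG CG G SK SigIdxG : Type}
variable [NormedAddCommGroup H] [InnerProductSpace ℂ H] [CompleteSpace H]
variable [NormedAddCommGroup HG] [InnerProductSpace ℂ HG] [CompleteSpace HG]
variable [NormedAddCommGroup CG] [NormedSpace ℂ CG]
variable [Group G] [TopologicalSpace G] [TopologicalSpace SK]
variable {C : RepCoreCarrier H HG CG G SK SigIdxG} (D : RepTorusCarrier C)

/-- **`E_w`, DEFINED** (ll. 390–391): the joint `w`-eigenspace of the torus under `R`. -/
def Ew : Submodule ℂ H := RepDecomp.Ew C.R D.torus D.w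

/-- **"`w` occurs in `σ_∞|_T`", DEFINED** (ll. 387–390). -/
def wOccurs (c : C.SigIdx) : Prop := RepDecomp.WOccurs C.R D.torus D.w c

/-- **The gen-2 torus carrier of a representation-theoretic one.** -/
def toTorusCarrier : TorusCarrier C.toCoreCarrier where
  X := D.X
  TestFn := D.TestFn
  allowed := D.allowed
  ϑc := D.ϑc
  E := D.E
  Ew := RepDecomp.Ew C.R D.torus D.w
  wOccurs := fun c => RepDecomp.WOccurs C.R D.torus D.w c
  ETransl := D.ETransl

/-- (Ported verbatim from the HodgeCMPerL package; no docstring in the source.) -/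
@[simp] theorem toTorusCarrier_X : D.toTorusCarrier.X = D.X := rfl
/-- (Ported verbatim from the HodgeCMPerL package; no docstring in the source.) -/
@[simp] theorem toTorusCarrier_TestFn : D.toTorusCarrier.TestFn = D.TestFn := rfl
/-- (Ported verbatim from the HodgeCMPerL package; no docstring in the source.) -/
@[simp] theorem toTorusCarrier_ϑc : D.toTorusCarrier.ϑc = D.ϑc := rfl
/-- (Ported verbatim from the HodgeCMPerL package; no docstring in the source.) -/
@[simp] theorem toTorusCarrier_E : D.toTorusCarrier.E = D.E := rfl
/-- (Ported verbatim from the HodgeCMPerL package; no docstring in the source.) -/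
theorem toTorusCarrier_Ew : D.toTorusCarrier.Ew = D.Ew := rfl
/-- (Ported verbatim from the HodgeCMPerL package; no docstring in the source.) -/
theorem toTorusCarrier_wOccurs (c : C.SigIdx) : D.toTorusCarrier.wOccurs c = D.wOccurs c := rfl
/-- (Ported verbatim from the HodgeCMPerL package; no docstring in the source.) -/
@[simp] theorem toTorusCarrier_ETransl : D.toTorusCarrier.ETransl = D.ETransl := rfl

/-- `E_w` is closed: the carrier's `EwC` IS `E_w`. -/
theorem toTorusCarrier_EwC : D.toTorusCarrier.EwC = D.Ew :=
  (RepDecomp.isClosed_Ew C.R D.torus D.w).submodule_topologicalClosure_eq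

/-- **The remaining analytic axioms of one torus side — 6 of gen 2's 7** (`AX9_w_vector` is a theorem for the
defined `σ̂`, `E_w`, `wOccurs`: `toTorusCarrier_analytic`).  Field statements verbatim gen 2's, over the gen-2
carrier of `D`. -/
structure Analytic : Prop where
  /-- AX5b: `Φ ↦ ϑ_{T,χ}(Φ)` is continuous into `C([G_U])`. -/
  AX5b_ϑ_cont : ∀ χ, Continuous (D.ϑc χ)
  /-- AX12: `h ↦ ϑ_{T,χ}(ω(h)Φ)` is continuous `U(W)(𝔸) → C([G_U])`. -/
  AX12_transl_cont : ∀ χ (Φ : SK), Continuous fun h : G => D.ϑc χ (C.omg h Φ)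
  /-- ll. 410–411: `R(h₀) E^χ_f = E^χ_{f^{h₀}}`. -/
  AX12_E_transl : ∀ (h : G) χ f, C.R h (D.E χ f) = D.E χ (D.ETransl h χ f)
  /-- AX12, first unfolding identity, integral-free. -/
  AX12_unfold_lift : ∀ (Φ : SK) χ f, (C.toCoreCarrier.TΦ Φ) (D.E χ f) ∈ (Submodule.span ℂ
    (Set.range fun h : G => C.inclCG (D.ϑc χ (C.omg h Φ)))).topologicalClosure
  /-- AX12 + AX5b, the approximate-identity limit of Thm 3.7's proof. -/
  AX12_molly : ∀ χ (Φ : SK),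
    C.inclCG (D.ϑc χ Φ) ∈ closure (Set.range fun f : D.TestFn => (C.toCoreCarrier.TΦ Φ) (D.E χ f))
  /-- Prop 3.6 Step 2 (ll. 423–434): a vector orthogonal to every `E^χ_f` has vanishing `w`-isotypic part. -/
  AX8_annihilation : ∀ v : H, (∀ χ f, ⟪D.E χ f, v⟫_ℂ = 0) → D.toTorusCarrier.Pw v = 0

variable {D}

/-- **Gen 2's seven torus-side axioms from the six**: `AX9_w_vector` is PROVED (`RepDecomp.exists_wvector` — Schur
applied to the equivariant isometries from the member carrying the `w`-vector — and `E_w ≤ closure E_w`). -/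
theorem toTorusCarrier_analytic (hC : C.Analytic) (hD : D.Analytic) : D.toTorusCarrier.Analytic where
  AX5b_ϑ_cont := hD.AX5b_ϑ_cont
  AX12_transl_cont := hD.AX12_transl_cont
  AX12_E_transl := hD.AX12_E_transl
  AX12_unfold_lift := hD.AX12_unfold_lift
  AX12_molly := hD.AX12_molly
  AX8_annihilation := hD.AX8_annihilation
  AX9_w_vector := fun M hM hinv c hocc hne => by
    obtain ⟨v, hv, hv0, hvE⟩ := RepDecomp.exists_wvector D.torus D.w hC.isUnitaryRep hocc M hM hinv hne
    exact ⟨v, hv, hv0, (D.toTorusCarrier.Pw_eq_self_iff v).mpr (D.toTorusCarrier.Ew.le_topologicalClosure hvE)⟩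

end RepTorusCarrier

/-! ## 3. The universe-indexed carrier and the theta model of a representation-theoretic carrier -/

namespace Universe

variable (U : Universe)

/-- **The representation-theoretic theta carrier**: gen 2's `U.ThetaCarrier` WITHOUT the index family `SigIdx`, with
`core`/`t12`/`t34` the representation-theoretic carriers.  NO propositional content. -/
structure RepThetaCarrier where
  /-- `L²([G_U])` -/
  HG : ∀ (L : CMField) (ι₁ : L →+* ℂ), HermSpace3 L ι₁ → Type
  [instHG₁ : ∀ L ι₁ V, NormedAddCommGroup (HG L ι₁ V)]
  [instHG₂ : ∀ L ι₁ V, InnerProductSpace ℂ (HG L ι₁ V)]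
  [instHG₃ : ∀ L ι₁ V, CompleteSpace (HG L ι₁ V)]
  /-- degree-two classes of `P_Γ` as `L²` functions on `[G_U]` -/
  emb : ∀ {L : CMField} {ι₁ : L →+* ℂ} {V : HermSpace3 L ι₁} (Γ : Level V),
    U.CohC (U.pms L ι₁ V Γ) 2 →ₗ[ℂ] HG L ι₁ V
  /-- the covering `P_{Γ'} → P_Γ` for `Γ' ≤ Γ` -/
  cover : ∀ {L : CMField} {ι₁ : L →+* ℂ} {V : HermSpace3 L ι₁} (Γ Γ' : Level V),
    Γ'.Γ ≤ Γ.Γ → U.Mor (U.pms L ι₁ V Γ') (U.pms L ι₁ V Γ)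
  /-- sign recipe, first half -/
  kappa : ∀ (K L : CMField), (K →+* L) → (L →+* ℂ) → (L →+* ℂ) → (K →+* ℂ)
  /-- sign recipe, second half -/
  frameSign : ∀ (L : CMField), (L →+* ℂ) → (L →+* ℂ) → Bool
  /-- `L²([U(W)])` -/
  H : ∀ {L : CMField} {ι₁ : L →+* ℂ}, HermSpace3 L ι₁ → SeesawCtx L → Type
  /-- `C([G_U])` -/
  CG : ∀ {L : CMField} {ι₁ : L →+* ℂ}, HermSpace3 L ι₁ → SeesawCtx L → Type
  /-- `U(W)(𝔸)` -/
  G : ∀ {L : CMField} {ι₁ : L →+* ℂ}, HermSpace3 L ι₁ → SeesawCtx L → Type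
  /-- `𝒮^κ` -/
  SK : ∀ {L : CMField} {ι₁ : L →+* ℂ}, HermSpace3 L ι₁ → SeesawCtx L → Type
  /-- index type of the isotypic decomposition of `L²([G_U])` -/
  SigIdxG : ∀ {L : CMField} {ι₁ : L →+* ℂ}, HermSpace3 L ι₁ → SeesawCtx L → Type
  [instH₁ : ∀ {L : CMField} {ι₁ : L →+* ℂ} (V : HermSpace3 L ι₁) (c : SeesawCtx L), NormedAddCommGroup (H V c)]
  [instH₂ : ∀ {L : CMField} {ι₁ : L →+* ℂ} (V : HermSpace3 L ι₁) (c : SeesawCtx L), InnerProductSpace ℂ (H V c)]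
  [instH₃ : ∀ {L : CMField} {ι₁ : L →+* ℂ} (V : HermSpace3 L ι₁) (c : SeesawCtx L), CompleteSpace (H V c)]
  [instCG₁ : ∀ {L : CMField} {ι₁ : L →+* ℂ} (V : HermSpace3 L ι₁) (c : SeesawCtx L), NormedAddCommGroup (CG V c)]
  [instCG₂ : ∀ {L : CMField} {ι₁ : L →+* ℂ} (V : HermSpace3 L ι₁) (c : SeesawCtx L), NormedSpace ℂ (CG V c)]
  [instG₁ : ∀ {L : CMField} {ι₁ : L →+* ℂ} (V : HermSpace3 L ι₁) (c : SeesawCtx L), Group (G V c)]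
  [instG₂ : ∀ {L : CMField} {ι₁ : L →+* ℂ} (V : HermSpace3 L ι₁) (c : SeesawCtx L), TopologicalSpace (G V c)]
  [instSK : ∀ {L : CMField} {ι₁ : L →+* ℂ} (V : HermSpace3 L ι₁) (c : SeesawCtx L), TopologicalSpace (SK V c)]
  /-- the representation-theoretic core of the context -/
  core : ∀ {L : CMField} {ι₁ : L →+* ℂ} (V : HermSpace3 L ι₁) (c : SeesawCtx L),
    RepCoreCarrier (H V c) (HG L ι₁ V) (CG V c) (G V c) (SK V c) (SigIdxG V c)
  /-- the (12) torus side -/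
  t12 : ∀ {L : CMField} {ι₁ : L →+* ℂ} (V : HermSpace3 L ι₁) (c : SeesawCtx L), RepTorusCarrier (core V c)
  /-- the (34) torus side -/
  t34 : ∀ {L : CMField} {ι₁ : L →+* ℂ} (V : HermSpace3 L ι₁) (c : SeesawCtx L), RepTorusCarrier (core V c)
  /-- the theta one-forms of type `Ψ_i` at level `Γ` -/
  Theta : ∀ {L : CMField} {ι₁ : L →+* ℂ} (V : HermSpace3 L ι₁), SeesawCtx L → Fin 4 → ∀ Γ : Level V,
    Set (U.CohC (U.pms L ι₁ V Γ) 1)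

attribute [instance] RepThetaCarrier.instHG₁ RepThetaCarrier.instHG₂ RepThetaCarrier.instHG₃
  RepThetaCarrier.instH₁ RepThetaCarrier.instH₂ RepThetaCarrier.instH₃ RepThetaCarrier.instCG₁
  RepThetaCarrier.instCG₂ RepThetaCarrier.instG₁ RepThetaCarrier.instG₂ RepThetaCarrier.instSK

namespace RepThetaCarrier

variable {U}
variable (D : U.RepThetaCarrier)

/-- **The gen-2 theta carrier of a representation-theoretic one**: `SigIdx V c :=` the equivalence classes of
irreducibles of `R` in the context, the context carriers converted by `toCoreCarrier` / `toTorusCarrier`. -/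
def toThetaCarrier : U.ThetaCarrier where
  HG := D.HG
  emb := D.emb
  cover := D.cover
  kappa := D.kappa
  frameSign := D.frameSign
  H := D.H
  CG := D.CG
  G := D.G
  SK := D.SK
  SigIdx := fun V c => (D.core V c).SigIdx
  SigIdxG := D.SigIdxG
  core := fun V c => (D.core V c).toCoreCarrier
  t12 := fun V c => (D.t12 V c).toTorusCarrier
  t34 := fun V c => (D.t34 V c).toTorusCarrier
  Theta := D.Theta

/-- **The analytic hypotheses of a representation-theoretic theta carrier**: per seesaw context the 3 core axioms and
the 6 axioms of each torus side — 15 named propositions per context (gen 2: 20).  A `Prop`; enters every theorem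
ONLY as an explicit hypothesis `(hA : D.Analytic)`. -/
structure Analytic : Prop where
  core : ∀ {L : CMField} {ι₁ : L →+* ℂ} (V : HermSpace3 L ι₁) (c : SeesawCtx L), (D.core V c).Analytic
  t12 : ∀ {L : CMField} {ι₁ : L →+* ℂ} (V : HermSpace3 L ι₁) (c : SeesawCtx L), (D.t12 V c).Analytic
  t34 : ∀ {L : CMField} {ι₁ : L →+* ℂ} (V : HermSpace3 L ι₁) (c : SeesawCtx L), (D.t34 V c).Analytic

variable {D}

/-- **Gen 2's twenty axioms per context from the fifteen.** -/
theorem Analytic.toThetaCarrier (hA : D.Analytic) : D.toThetaCarrier.Analytic where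
  core := fun V c => RepCoreCarrier.toCoreCarrier_analytic (hA.core V c)
  t12 := fun V c => RepTorusCarrier.toTorusCarrier_analytic (hA.core V c) (hA.t12 V c)
  t34 := fun V c => RepTorusCarrier.toTorusCarrier_analytic (hA.core V c) (hA.t34 V c)

end RepThetaCarrier

namespace ThetaModel

variable {U}

/-- **The theta model of a representation-theoretic carrier**: `ofCarrier` of the converted carrier. -/
def ofRepCarrier (D : U.RepThetaCarrier) (hA : D.Analytic) : U.ThetaModel :=
  ofCarrier D.toThetaCarrier hA.toThetaCarrier

/-- (Ported verbatim from the HodgeCMPerL package; no docstring in the source.) -/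
theorem ofRepCarrier_eq (D : U.RepThetaCarrier) (hA : D.Analytic) :
    ofRepCarrier D hA = ofCarrier D.toThetaCarrier hA.toThetaCarrier := rfl

end ThetaModel

end Universe

/-! ## 4. The headline theorems over a representation-theoretic carrier -/

namespace Assembly

open HodgeCM.PerL34 HodgeCM.PerL34.ArchC
open HodgeCM.Universe (RepThetaCarrier ThetaModel)

variable (U : Universe)


-- port_pkg: scope closed for this part
end Assembly
end HodgeCM
end
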